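import Mathlib.Algebra.QuadraticDiscriminant
import Mathlib.Algebra.BigOperators.Fin
import Mathlib.Data.Real.Basic
import Mathlib.Analysis.SpecialFunctions.Pow.Real
import HarnessLib

/-!
# Odd-shift Hankel positivity ⇒ log-convexity of 2-block sums

A reflection-positivity lemma in sequence form. Let `F : ℕ → ℝ` and suppose the *odd-shift Hankel
form* `(c, c') ↦ ∑_{i,j<N} c_i c'_j F(i+j+1)` is positive semidefinite (this is what bond-plane
reflection positivity of a translation-invariant two-point function delivers along an axis:
separations across a plane between sites are `i + j + 1`, Fröhlich–Israel–Lieb–Simon 1978 /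
Dyson–Lieb–Simon 1978; for ground states Kennedy–Lieb–Shastry 1988). Put
`G(j) = F(j-1) + 2F(j) + F(j+1)` — the correlation of two BLOCKS of two consecutive sites at
separation `j` when `F` is a site two-point function. Testing the form on the block vectors
`δ_i + δ_{i+1}` gives `G(2i+2)` on the diagonal and `G(i+k+2)` off the diagonal, so Cauchy–Schwarz
yields

* `hankelBlock_sq_le` — `G(i+k+2)² ≤ G(2i+2) · G(2k+2)` for `i + 2 ≤ N`, `k + 2 ≤ N`;
* `hankelBlock_logConvex` — in particular `G(2n)² ≤ G(2n-2) · G(2n+2)` for `2 ≤ n`, `n + 2 ≤ N`: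
  the block sums at EVEN separations (= the 2-block kernel along a coarse axis) are log-convex at
  every centre `n ≥ 2`, although the Hankel hypothesis only involves odd site separations.

The centre `n = 1` (`G(0) G(4) ≥ G(2)²`, `G(0)` containing `F(0)`) is NOT a consequence (it is the
genuinely non-RP part of axis infinite divisibility of 2×2-block kernels; crux `Block2InfDivXXZ` of
route `LevyLogBootstrap`, summit HubbardSuperconductivity, prover analysis 2026-08-17).
Elementary; [folklore] throughout (Cauchy–Schwarz for a positive semidefinite form).
-/

noncomputable section

open Finset
open scoped BigOperators

namespace Literature.Analysis.Matrix

/-- The odd-shift Hankel bilinear form of a sequence `F` on `ℝ^N`: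
`hankelOddForm F N u w = ∑_{i,j} u_i w_j F(i+j+1)`. [folklore] -/
def hankelOddForm (F : ℕ → ℝ) (N : ℕ) (u w : Fin N → ℝ) : ℝ :=
  ∑ i : Fin N, ∑ j : Fin N, u i * w j * F (i.val + j.val + 1)

/-- The 2-block sum of a sequence: `twoBlockSum F j = F(j-1) + 2F(j) + F(j+1)` (correlation of
the blocks `{0,1}` and `{j, j+1}` when `F` is a two-point function of the separation). [folklore] -/
def twoBlockSum (F : ℕ → ℝ) (j : ℕ) : ℝ := F (j - 1) + 2 * F j + F (j + 1)

variable (F : ℕ → ℝ) (N : ℕ)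

/-- Symmetry of the Hankel form. [folklore] -/
theorem hankelOddForm_comm (u w : Fin N → ℝ) :
    hankelOddForm F N u w = hankelOddForm F N w u := by
  unfold hankelOddForm
  rw [Finset.sum_comm]
  refine Finset.sum_congr rfl fun i _ => Finset.sum_congr rfl fun j _ => ?_
  rw [Nat.add_comm j.val i.val]
  ring

/-- Additivity in the first argument. [folklore] -/
theorem hankelOddForm_add_left (u₁ u₂ w : Fin N → ℝ) :
    hankelOddForm F N (u₁ + u₂) w = hankelOddForm F N u₁ w + hankelOddForm F N u₂ w := by
  unfold hankelOddForm
  rw [← Finset.sum_add_distrib]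
  refine Finset.sum_congr rfl fun i _ => ?_
  rw [← Finset.sum_add_distrib]
  refine Finset.sum_congr rfl fun j _ => ?_
  simp only [Pi.add_apply]
  ring

/-- Additivity in the second argument. [folklore] -/
theorem hankelOddForm_add_right (u w₁ w₂ : Fin N → ℝ) :
    hankelOddForm F N u (w₁ + w₂) = hankelOddForm F N u w₁ + hankelOddForm F N u w₂ := by
  rw [hankelOddForm_comm, hankelOddForm_add_left, hankelOddForm_comm F N w₁,
    hankelOddForm_comm F N w₂]

/-- Homogeneity in the second argument. [folklore] -/
theorem hankelOddForm_smul_right (u w : Fin N → ℝ) (t : ℝ) :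
    hankelOddForm F N u (t • w) = t * hankelOddForm F N u w := by
  unfold hankelOddForm
  rw [Finset.mul_sum]
  refine Finset.sum_congr rfl fun i _ => ?_
  rw [Finset.mul_sum]
  refine Finset.sum_congr rfl fun j _ => ?_
  simp only [Pi.smul_apply, smul_eq_mul]
  ring

/-- Homogeneity in the first argument. [folklore] -/
theorem hankelOddForm_smul_left (u w : Fin N → ℝ) (t : ℝ) :
    hankelOddForm F N (t • u) w = t * hankelOddForm F N u w := by
  rw [hankelOddForm_comm, hankelOddForm_smul_right, hankelOddForm_comm]

/-- The form on two coordinate vectors picks out one Hankel entry: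
`⟨δ_a, δ_b⟩ = F(a+b+1)`. [folklore] -/
theorem hankelOddForm_single_single (a b : Fin N) :
    hankelOddForm F N (fun l => if l = a then 1 else 0) (fun l => if l = b then 1 else 0) =
      F (a.val + b.val + 1) := by
  unfold hankelOddForm
  rw [Finset.sum_eq_single a (fun i _ hi => by simp [hi]) (fun h => (h (Finset.mem_univ a)).elim),
    Finset.sum_eq_single b (fun j _ hj => by simp [hj]) (fun h => (h (Finset.mem_univ b)).elim)]
  simp

/-- **Cauchy–Schwarz for the positive semidefinite Hankel form.** [folklore] -/
theorem hankelOddForm_sq_le (hpsd : ∀ c : Fin N → ℝ, 0 ≤ hankelOddForm F N c c)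
    (u w : Fin N → ℝ) :
    hankelOddForm F N u w ^ 2 ≤ hankelOddForm F N u u * hankelOddForm F N w w := by
  -- `0 ≤ ⟨u + t w, u + t w⟩ = ⟨w,w⟩ t² + 2⟨u,w⟩ t + ⟨u,u⟩` for all `t`
  have hquad : ∀ t : ℝ, 0 ≤ hankelOddForm F N w w * (t * t) + 2 * hankelOddForm F N u w * t +
      hankelOddForm F N u u := by
    intro t
    have h := hpsd (u + t • w)
    rw [hankelOddForm_add_left, hankelOddForm_add_right, hankelOddForm_add_right,
      hankelOddForm_smul_right, hankelOddForm_smul_left, hankelOddForm_smul_left,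
      hankelOddForm_smul_right, hankelOddForm_comm F N w u] at h
    nlinarith [h]
  have hd := discrim_le_zero hquad
  rw [discrim] at hd
  nlinarith [hd]

/-- The Hankel form on the block vector `δ_i + δ_{i+1}` against `δ_k + δ_{k+1}` is the 2-block
sum at separation `i + k + 2`: `F(i+k+1) + 2F(i+k+2) + F(i+k+3)`. [folklore] -/
theorem hankelOddForm_blockVec (i k : ℕ) (hi : i + 2 ≤ N) (hk : k + 2 ≤ N) :
    hankelOddForm F N
        ((fun l => if l = (⟨i, by omega⟩ : Fin N) then 1 else 0) +
          fun l => if l = (⟨i + 1, by omega⟩ : Fin N) then 1 else 0)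
        ((fun l => if l = (⟨k, by omega⟩ : Fin N) then 1 else 0) +
          fun l => if l = (⟨k + 1, by omega⟩ : Fin N) then 1 else 0) =
      twoBlockSum F (i + k + 2) := by
  rw [hankelOddForm_add_left, hankelOddForm_add_right, hankelOddForm_add_right,
    hankelOddForm_single_single, hankelOddForm_single_single, hankelOddForm_single_single,
    hankelOddForm_single_single, twoBlockSum]
  simp only
  have e1 : i + (k + 1) + 1 = i + k + 2 := by omega
  have e2 : i + 1 + k + 1 = i + k + 2 := by omega
  have e3 : i + 1 + (k + 1) + 1 = i + k + 2 + 1 := by omega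
  have e0 : i + k + 2 - 1 = i + k + 1 := by omega
  rw [e1, e2, e3, e0]
  ring

/-- **Odd-shift Hankel positivity ⇒ `G(i+k+2)² ≤ G(2i+2)·G(2k+2)`** for the 2-block sums
`G = twoBlockSum F`, whenever `i + 2 ≤ N` and `k + 2 ≤ N`. [folklore] -/
theorem hankelBlock_sq_le (hpsd : ∀ c : Fin N → ℝ, 0 ≤ hankelOddForm F N c c) (i k : ℕ)
    (hi : i + 2 ≤ N) (hk : k + 2 ≤ N) :
    twoBlockSum F (i + k + 2) ^ 2 ≤ twoBlockSum F (2 * i + 2) * twoBlockSum F (2 * k + 2) := by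
  have h := hankelOddForm_sq_le F N hpsd
    ((fun l => if l = (⟨i, by omega⟩ : Fin N) then 1 else 0) +
      fun l => if l = (⟨i + 1, by omega⟩ : Fin N) then 1 else 0)
    ((fun l => if l = (⟨k, by omega⟩ : Fin N) then 1 else 0) +
      fun l => if l = (⟨k + 1, by omega⟩ : Fin N) then 1 else 0)
  rw [hankelOddForm_blockVec F N i k hi hk, hankelOddForm_blockVec F N i i hi hi,
    hankelOddForm_blockVec F N k k hk hk] at h
  have e1 : i + i + 2 = 2 * i + 2 := by omega
  have e2 : k + k + 2 = 2 * k + 2 := by omega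
  rw [e1, e2] at h
  exact h

/-- **Log-convexity of the 2-block kernel along an axis at every centre `n ≥ 2`** from odd-shift
Hankel positivity: `G(2n)² ≤ G(2n-2) · G(2n+2)` for `2 ≤ n`, `n + 2 ≤ N`, `G = twoBlockSum F`.
(The case `n = 1` is not implied.) [folklore] -/
theorem hankelBlock_logConvex (hpsd : ∀ c : Fin N → ℝ, 0 ≤ hankelOddForm F N c c) (n : ℕ)
    (hn : 2 ≤ n) (hnN : n + 2 ≤ N) :
    twoBlockSum F (2 * n) ^ 2 ≤ twoBlockSum F (2 * n - 2) * twoBlockSum F (2 * n + 2) := by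
  have h := hankelBlock_sq_le F N hpsd (n - 2) n (by omega) hnN
  have e1 : n - 2 + n + 2 = 2 * n := by omega
  have e2 : 2 * (n - 2) + 2 = 2 * n - 2 := by omega
  rw [e1, e2] at h
  exact h

/-- Log-convexity in logarithmic form: if moreover the block sums are positive then
`2 log G(2n) ≤ log G(2n-2) + log G(2n+2)` (`2 ≤ n`, `n + 2 ≤ N`). [folklore] -/
theorem hankelBlock_log_midpoint_le (hpsd : ∀ c : Fin N → ℝ, 0 ≤ hankelOddForm F N c c)
    (hpos : ∀ j, 0 < twoBlockSum F j) (n : ℕ) (hn : 2 ≤ n) (hnN : n + 2 ≤ N) :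
    2 * Real.log (twoBlockSum F (2 * n)) ≤
      Real.log (twoBlockSum F (2 * n - 2)) + Real.log (twoBlockSum F (2 * n + 2)) := by
  have h := hankelBlock_logConvex F N hpsd n hn hnN
  have h2 : Real.log (twoBlockSum F (2 * n) ^ 2) ≤
      Real.log (twoBlockSum F (2 * n - 2) * twoBlockSum F (2 * n + 2)) :=
    Real.log_le_log (pow_pos (hpos _) 2) h
  rw [Real.log_pow, Real.log_mul (hpos _).ne' (hpos _).ne'] at h2
  simpa only [Nat.cast_ofNat] using h2

end Literature.Analysis.Matrix

end
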